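import Mathlib
import HarnessLib
import Literature.Combinatorics.Additive.KempermanDecompositionExistence

/-!
# Grynkiewicz 2009, §6 Claim 5 (case `l = 4`): KST for the pair `(φ_H(A), φ_H(B))`

[cite: Grynkiewicz2009, §6 Claim 5 (proof of Thm 4.1, p. 25: «In view of the maximality of H, it follows that φ_H(A + B) is aperiodic. Hence, in view of (40), it follows that we can apply KST to the pair (φ_H(A), φ_H(B))»)] [tag: critical-pair] [tag: inverse-theorem]

Topic `Literature/Combinatorics/Additive`.  Cell `mm-stpp` (D-0046), seat `mm-stpp-lit` (gen 23); the
port of D. J. Grynkiewicz, *A step beyond Kemperman's structure theorem*, Mathematika **55** (2009)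
67–114 continued.  In the last case `l = 4` of §6 Claim 5 (print pp. 25–26; the frame is delivered by
`seventeen_or_fourPairs` in `StepBeyondKempermanTwoHolesReduction.lean`) the print applies the
Kemperman Structure Theorem IN THE QUOTIENT `G/H`: «In view of the maximality of `H`, it follows that
`φ_H(A + B)` is aperiodic.  Hence, in view of (40), it follows that we can apply KST to the pair
`(φ_H(A), φ_H(B))`.  Let `φ_H(A₁′) ∪ φ_H(A₀′)` and `φ_H(B₁′) ∪ φ_H(B₀′)` be the Kemperman decompositions
with quasi-period `L/H` …».  This file provides exactly that step, generically:
* `not_isPeriodic_image_mk_of_addStab_eq` — MAXIMALITY OF THE PERIOD: if `H = H(C + H)` is the full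
  stabilizer of the `H`-periodic set `C + H`, then `φ_H(C) ⊆ G/H` is aperiodic;
* `image_mk_add'` — `φ_H(A + B) = φ_H(A) + φ_H(B)`;
* `mem_add_carrier_iff_image_mk` — `z ∈ C + H ↔ φ_H(z) ∈ φ_H(C)`;
* `exists_isKempermanDecompI_image_mk` — **KST FOR `(φ_H(A), φ_H(B))`**: for finite `G`, `H ≠ G` the
  full stabilizer of `A + B + H`, and (40) `|φ_H(A + B)| + 1 = |φ_H(A)| + |φ_H(B)|`, the pair
  `(φ_H(A), φ_H(B))` of finsets of `G ⧸ H` has a Kemperman decomposition (the tree's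
  `IsKempermanDecompI`, via `exists_isKempermanDecompI_of_not_isPeriodic'`).

MAIN RESULTS as listed (0 definitions, 0 named facts; everything PROVED).

## References
* D. J. Grynkiewicz, *A step beyond Kemperman's structure theorem*, Mathematika 55 (2009) 67–114,
  doi:10.1112/S0025579300000966, §6 Claim 5 (p. 25), display (40); §2 (KST)
  [cite: Grynkiewicz2009, Thm 4.1 (proof, Claim 5)] — held `paper:doi-10-1112-s0025579300000966`,
  p0025 read 2026-08-29.
-/

namespace Literature.Combinatorics.Additive

open Finset
open scoped Pointwise

universe u

variable {G : Type u} [AddCommGroup G] [DecidableEq G]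

namespace Grynkiewicz2009

/-- `z ∈ C + H ↔ φ_H(z) ∈ φ_H(C)` (`H` carried as the finset `Hf`). [cite: Grynkiewicz2009, §2 (notation φ_H)] -/
theorem mem_add_carrier_iff_image_mk {C Hf : Finset G} {H : AddSubgroup G} [DecidableEq (G ⧸ H)]
    (hHf : ∀ g, g ∈ Hf ↔ g ∈ H) (z : G) :
    z ∈ C + Hf ↔ (QuotientAddGroup.mk z : G ⧸ H) ∈ C.image (QuotientAddGroup.mk : G → G ⧸ H) := by
  constructor
  · intro hz
    obtain ⟨c, hc, h, hh, rfl⟩ := mem_add.1 hz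
    refine mem_image.2 ⟨c, hc, ?_⟩
    rw [QuotientAddGroup.mk_add, (QuotientAddGroup.eq_zero_iff h).2 ((hHf h).1 hh), add_zero]
  · intro hz
    obtain ⟨c, hc, hcz⟩ := mem_image.1 hz
    rw [QuotientAddGroup.eq] at hcz
    exact mem_add.2 ⟨c, hc, -c + z, (hHf _).2 hcz, by abel⟩

/-- `φ_H(A + B) = φ_H(A) + φ_H(B)`. [cite: Grynkiewicz2009, §2 (notation φ_H)] -/
theorem image_mk_add' (H : AddSubgroup G) [DecidableEq (G ⧸ H)] (A B : Finset G) :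
    (A + B).image (QuotientAddGroup.mk : G → G ⧸ H) =
      A.image (QuotientAddGroup.mk : G → G ⧸ H) + B.image (QuotientAddGroup.mk : G → G ⧸ H) := by
  rw [← QuotientAddGroup.coe_mk', image_add]

/-- **Maximality of the period ⟹ `φ_H(C)` aperiodic.**  If `H` is the FULL stabilizer of the
`H`-periodic set `C + H` (`(C + H).addStab = H` as finsets) and `C ≠ ∅`, then `φ_H(C) ⊆ G/H` is not
periodic: a period `q = φ_H(l)` of `φ_H(C)` makes `l` a period of `C + H = φ_H⁻¹(φ_H(C))`, so `l ∈ H`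
and `q = 0`. [cite: Grynkiewicz2009, §6 Claim 5 («In view of the maximality of H, φ_H(A + B) is
aperiodic»)] -/
theorem not_isPeriodic_image_mk_of_addStab_eq {C Hf : Finset G} {H : AddSubgroup G}
    [DecidableEq (G ⧸ H)] (hHf : ∀ g, g ∈ Hf ↔ g ∈ H) (hstab : (C + Hf).addStab = Hf)
    (hCne : C.Nonempty) : ¬ IsPeriodic (C.image (QuotientAddGroup.mk : G → G ⧸ H)) := by
  rintro ⟨Q, hQ, hQper⟩
  have h0 : (0 : G) ∈ Hf := (hHf 0).2 H.zero_mem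
  have hCHne : (C + Hf).Nonempty := hCne.add ⟨0, h0⟩
  apply hQ
  refine (AddSubgroup.eq_bot_iff_forall Q).2 fun q hq => ?_
  obtain ⟨l, rfl⟩ := QuotientAddGroup.mk_surjective q
  -- `l` is a period of `C + Hf`
  have hl : l +ᵥ (C + Hf) = C + Hf := by
    refine eq_of_subset_of_card_le (fun w hw => ?_) (by rw [card_vadd_finset])
    obtain ⟨z, hz, rfl⟩ := mem_vadd_finset.1 hw
    rw [mem_add_carrier_iff_image_mk hHf] at hz ⊢
    rw [vadd_eq_add, QuotientAddGroup.mk_add, ← vadd_eq_add, ← hQper _ hq]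
    exact vadd_mem_vadd_finset hz
  have hlH : l ∈ H := (hHf l).1 (by rw [← hstab]; exact (mem_addStab hCHne).2 hl)
  exact (QuotientAddGroup.eq_zero_iff l).2 hlH

/-- **KST for `(φ_H(A), φ_H(B))` (Claim 5, case `l = 4`).**  For finite `G`, a proper subgroup `H`
that is the full stabilizer of `A + B + H`, nonempty `A, B`, and (40)
`|φ_H(A + B)| + 1 = |φ_H(A)| + |φ_H(B)|`: the pair `(φ_H(A), φ_H(B))` of finsets of `G ⧸ H` satisfies
`|φ_H(A) + φ_H(B)| = |φ_H(A)| + |φ_H(B)| − 1` with `φ_H(A) + φ_H(B) = φ_H(A + B)` aperiodic, so the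
Kemperman Structure Theorem (tree: `exists_isKempermanDecompI_of_not_isPeriodic'`) gives quasi-periodic
decompositions `φ_H(A) = A₁ ∪ A₀`, `φ_H(B) = B₁ ∪ B₀` with a common quasi-period `L/H` and
(i), (ii), (iv). [cite: Grynkiewicz2009, §6 Claim 5 (p. 25), display (40); KST] -/
theorem exists_isKempermanDecompI_image_mk [Fintype G] {A B Hf : Finset G} {H : AddSubgroup G}
    [DecidableEq (G ⧸ H)] (hHf : ∀ g, g ∈ Hf ↔ g ∈ H) (hHtop : H ≠ ⊤)
    (hstab : (A + B + Hf).addStab = Hf) (hA : A.Nonempty) (hB : B.Nonempty)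
    (h40 : cosetCount H (A + B) + 1 = cosetCount H A + cosetCount H B) :
    ∃ (L : AddSubgroup (G ⧸ H)) (A₁ A₀ B₁ B₀ : Finset (G ⧸ H)),
      IsKempermanDecompI L (A.image (QuotientAddGroup.mk : G → G ⧸ H))
        (B.image (QuotientAddGroup.mk : G → G ⧸ H)) A₁ A₀ B₁ B₀ := by
  classical
  haveI : Fintype (G ⧸ H) := Fintype.ofFinite _
  haveI : Nontrivial (G ⧸ H) := by
    obtain ⟨g, hg⟩ : ∃ g : G, g ∉ H := by
      by_contra hno
      push Not at hno
      exact hHtop ((AddSubgroup.eq_top_iff' H).2 hno)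
    exact nontrivial_of_ne (QuotientAddGroup.mk g) 0 fun h => hg ((QuotientAddGroup.eq_zero_iff g).1 h)
  have hap : ¬ IsPeriodic (A.image (QuotientAddGroup.mk : G → G ⧸ H) +
      B.image (QuotientAddGroup.mk : G → G ⧸ H)) := by
    rw [← image_mk_add']
    exact not_isPeriodic_image_mk_of_addStab_eq hHf hstab (hA.add hB)
  refine exists_isKempermanDecompI_of_not_isPeriodic' (hA.image _) (hB.image _) (le_of_eq ?_) hap
  rw [← image_mk_add', ← cosetCount_eq_card_image, ← cosetCount_eq_card_image,
    ← cosetCount_eq_card_image, h40]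

end Grynkiewicz2009

end Literature.Combinatorics.Additive
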